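import Mathlib.NumberTheory.LSeries.PrimesInAP
import Literature.NumberTheory.Automorphic.NewformAdelisationHeckeOperator
import Literature.NumberTheory.Automorphic.NewformAdelisationDescent
import Literature.NumberTheory.Automorphic.AutomorphicRepsGLSatakeFlathProofs
import Literature.NumberTheory.EllipticCurves.NewformsEigenpacketProofs
import HarnessLib

/-!
# A weight-one cusp form whose adelic lift lies in a clean automorphic representation is an
# eigenform, and its newform computes the Satake parameters (Gelbart 1997, Prop. 2.5 (b), (2.5.1)
# and Corollary, weight one)

Topic `NumberTheory/Automorphic`. Input: a clean automorphic representation `π = W / ⊥` of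
`GL₂(𝔸_ℚ)` (Borel–Jacquet datum, `AutomorphicRepsGL`) and a non-zero cusp form
`f ∈ S₁(Γ₁(N))` whose adelic lift `φ_f` (`adelicLiftFunA N 1 f`, `NewformAdelisationHeckeOperator`)
lies in `W` — the output of the descent `φ ↦ f_φ` on a `K₁(N)`-fixed weight-one vector
(`AutomorphicRepsGL2WeightOneCleanModel.exists_cuspForm_of_fixed`, where `φ_{f_ψ} = ψ`). Output:

* `CuspForm.eq_of_adelicLiftFun_ofRealGL_eq`, `CuspForm.eq_smul_of_adelicLiftFun_eq_smul` —
  **`f ↦ φ_f` is injective and detects scalars** (`φ_f((g, 1)) = archLift k f g`,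
  `archDescent_archLift`);
* `AutomorphicRepData.exists_heckeT_eq_smul_of_adelicLiftFunA_mem` — **`f` is an eigenform of
  `T_p` and `⟨p⟩` for every `p ∤ N`**, `T_p f = a_p f`, `⟨p⟩ f = e_p f`, and `φ_f` is an
  eigenvector of the adelic Hecke operators `T_{p,1}`, `T_{p,2}` of `HasSatakeParamAt` with
  eigenvalues `√p · a_p`, `e_p`: the unramified Hecke operators act by scalars on the `K(N)`-fixed
  vectors of `W` (`Flath1979_heckeOperator_ofLocal_sub_smul_mem_holds`, exact since `W' = ⊥`),
  `T_{p,1} φ_f = √p φ_{T_p f}` and `T_{p,2} φ_f = φ_{⟨p⟩ f}` (Gelbart 1975, Lemma 3.7: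
  `heckeOperator_principalCongruenceLevel_adelicLiftFunA_one/two`), and injectivity;
* `AutomorphicRepData.exists_mem_nebentypusSubspace_of_adelicLiftFunA_mem` — **`f ∈ S₁(N, χ)` for
  a Dirichlet character `χ`** (every unit class mod `N` contains a prime, Dirichlet/Mathlib
  `Nat.forall_exists_prime_gt_and_eq_mod`; `⟨d e⟩ = ⟨d⟩⟨e⟩`, `diamondOp_mul_holds`);
* `AutomorphicRepData.hasSatakeParamAt_of_adelicLiftFunA_mem` — **`π` has at every `p ∤ N` the
  Satake parameter `{α, β}` with `(X - α)(X - β) = X² - a_p X + χ(p)`** (Gelbart 1997, (2.5.1) with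
  `k = 1`: `a_p = μ₁(p) + μ₂(p)`, `χ(p) = μ₁(p) μ₂(p)`; the witness is `φ_f` itself);
* `AutomorphicRepData.exists_isNewform1_satake_of_adelicLiftFunA_mem` — **there is a newform
  `g₀ ∈ S₁(Γ₁(M₀))`, `M₀ ∣ N`, such that for every `p ∤ N` the Satake parameter of `π` at `p` has
  `(X - α)(X - β) =` the Hecke polynomial `X² - a_p(g₀) X + ε_{g₀}(p)` of `g₀`**
  (Atkin–Lehner–Li through `exists_isNewform1_of_eigenpacket`). This is the conclusion of the
  weight-one dictionary `hdesc` of `exists_isNewform1_of_isPiOfArtinRep_of_dictionary` at the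
  primes `p ∤ N`; the primes `p ∣ N`, `p ∤ M₀` require the new-vector/conductor theory
  (Casselman 1973) and are not treated here.

Everything is proved; no definition, no named fact.

## References

* S. Gelbart, *Three lectures on the modularity of `ρ̄_{E,3}` and the Langlands reciprocity
  conjecture* (1997), Prop. 2.5 (b), (2.5.1) and Corollary, proof of Prop. 4.2. [Gelbart1997]
* S. Gelbart, *Automorphic forms on adele groups* (1975), §3.B, Lemma 3.7, Prop. 3.1. [Gelbart1975]
* F. Diamond, J. Shurman, *A first course in modular forms* (2005), §5.2, Thm. 5.8.2–5.8.3.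
  [DiamondShurman2005]
-/

noncomputable section

open scoped MatrixGroups NumberField ModularForm UpperHalfPlane Polynomial Classical
open NumberField IsDedekindDomain Polynomial

namespace Literature.NumberTheory.Automorphic

open EllipticCurves.ModularForms CongruenceSubgroup Rat.HeightOneSpectrum

/-! ### `f ↦ φ_f` is injective and detects scalars -/

section Lift

variable {N : ℕ} [NeZero N] {k : ℤ}

/-- `φ_{c f}((g, 1)) = c φ_f((g, 1))` for `det g > 0` (the lift is linear in `f` at the
archimedean points, `adelicLiftFun_ofRealGL`, `archLift_apply_of_det_pos`). [cite: Gelbart1975, (3.4)] -/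
theorem adelicLiftFun_coe_smul_ofRealGL (c : ℂ) (f : CuspForm (Gamma1 N) k) {g : GL (Fin 2) ℝ}
    (hg : 0 < g.det.val) :
    adelicLiftFun N k ⇑(c • f) (Rat.ofRealGL 2 g) = c * adelicLiftFun N k ⇑f (Rat.ofRealGL 2 g) := by
  rw [adelicLiftFun_ofRealGL (c • f) hg, adelicLiftFun_ofRealGL f hg, archLift_apply_of_det_pos k _ hg,
    archLift_apply_of_det_pos k _ hg, CuspForm.IsGLPos.coe_smul, Pi.smul_apply, smul_eq_mul]
  ring

/-- **`f ↦ φ_f` is injective on `S_k(Γ₁(N))`** (even after restriction to `GL₂(ℝ)⁺ × {1}`):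
`φ_f((g, 1)) = archLift k f g` and `archDescent_archLift`. Gelbart 1997, Prop. 2.5, sketch of proof
("the map `f ↦ φ_f` is an isomorphism"). [cite: Gelbart1997, Prop. 2.5 (sketch of proof)] -/
theorem CuspForm.eq_of_adelicLiftFun_ofRealGL_eq {f₁ f₂ : CuspForm (Gamma1 N) k}
    (h : ∀ g : GL (Fin 2) ℝ, 0 < g.det.val →
      adelicLiftFun N k ⇑f₁ (Rat.ofRealGL 2 g) = adelicLiftFun N k ⇑f₂ (Rat.ofRealGL 2 g)) :
    f₁ = f₂ := by
  apply DFunLike.coe_injective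
  rw [← archDescent_archLift k ⇑f₁, ← archDescent_archLift k ⇑f₂]
  refine archDescent_congr k fun g hg => ?_
  rw [← adelicLiftFun_ofRealGL f₁ hg, ← adelicLiftFun_ofRealGL f₂ hg]
  exact h g hg

/-- **`φ_T = c φ_f` forces `T = c f`.** [cite: Gelbart1997, Prop. 2.5 (sketch of proof)] -/
theorem CuspForm.eq_smul_of_adelicLiftFun_eq_smul {f T : CuspForm (Gamma1 N) k} {c : ℂ}
    (h : adelicLiftFun N k ⇑T = c • adelicLiftFun N k ⇑f) : T = c • f :=
  CuspForm.eq_of_adelicLiftFun_ofRealGL_eq fun g hg => by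
    rw [adelicLiftFun_coe_smul_ofRealGL c f hg, ← smul_eq_mul, ← Pi.smul_apply, ← h]

end Lift

/-! ### Eigenform property and Satake parameters -/

/-- The rational prime under the place `primesEquiv.symm p` is `p`. [folklore] -/
theorem natGenerator_primesEquiv_symm' (p : Nat.Primes) :
    natGenerator ((primesEquiv (R := 𝓞 ℚ)).symm p) = p :=
  congrArg Subtype.val ((primesEquiv (R := 𝓞 ℚ)).apply_symm_apply p)

namespace AutomorphicRepData

variable {hcpt : isCompact_glFiniteIntegralLevel 2 ℚ} {π : AutomorphicRepData (AutomorphyDatum.gl 2 ℚ hcpt)}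
  {N : ℕ} [NeZero N]

attribute [local instance] neZero_natGenerator

omit [NeZero N] in
/-- `a • f = b • f` with `f ≠ 0` forces `a = b`. [folklore] -/
theorem smul_left_cancel_of_ne_zero {f : CuspForm (Gamma1 N) 1} (hf0 : f ≠ 0) {a b : ℂ}
    (h : a • f = b • f) : a = b := by
  by_contra hab
  have h' : (a - b) • f = 0 := by rw [sub_smul, h, sub_self]
  exact hf0 ((smul_eq_zero.mp h').resolve_left (sub_ne_zero.mpr hab))

/-- **`f` is a `T_p`- and `⟨p⟩`-eigenform at `p ∤ N` when `φ_f ∈ W`, `π = W / ⊥`**, with the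
adelic eigenvalue equations. For the place `v` over `p ∤ N`: the Hecke operators
`T_{v,1} = [K(N) diag(ϖ,1)_p K(N)]`, `T_{v,2} = [K(N) diag(ϖ,ϖ)_p K(N)]` act on the `K(N)`-fixed
vector `φ_f ∈ W` by scalars `c₁, c₂` (`Flath1979_heckeOperator_ofLocal_sub_smul_mem_holds`, exact
as `W' = ⊥`); `T_{v,1} φ_f = √p · φ_{T_p f}` and `T_{v,2} φ_f = φ_{⟨p⟩ f}` (Gelbart 1975,
Lemma 3.7); so `φ_{T_p f} = (c₁/√p) φ_f`, `φ_{⟨p⟩ f} = c₂ φ_f`, and `f ↦ φ_f` detects scalars.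
Gelbart 1997, Prop. 2.5 (b) and (2.5.1) (`p^{(k-1)/2}(μ₁(p) + μ₂(p)) = a_p`, here `k = 1`).
[cite: Gelbart1997, Prop. 2.5 (b), (2.5.1)] [cite: Gelbart1975, Lemma 3.7] -/
theorem exists_heckeT_eq_smul_of_adelicLiftFunA_mem (hbot : π.W' = ⊥) (f : CuspForm (Gamma1 N) 1)
    (hfW : adelicLiftFunA N 1 f ∈ π.W) {v : HeightOneSpectrum (𝓞 ℚ)} (hv : ¬ v.asIdeal ∣ Ideal.span {(N : 𝓞 ℚ)}) :
    ∃ a e : ℂ, EllipticCurves.ModularForms.heckeT (Gamma1 N) 1 (natGenerator v) f = a • f ∧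
      diamondOp N 1 ((natGenerator v : ℕ) : ZMod N) f = e • f ∧
      heckeOperator (rightTranslation (AdelicGroupData.gl 2 ℚ))
          (show Subgroup (AdelicGroupData.gl 2 ℚ).Adelic from principalCongruenceLevel 2 ℚ (Ideal.span {(N : 𝓞 ℚ)}))
          (heckeDiagAt 2 ℚ v (Rat.localUniformizer v) 1) (adelicLiftFunA N 1 f) =
        ((((Real.sqrt (natGenerator v) : ℝ) : ℂ)) * a) • adelicLiftFunA N 1 f ∧
      heckeOperator (rightTranslation (AdelicGroupData.gl 2 ℚ))
          (show Subgroup (AdelicGroupData.gl 2 ℚ).Adelic from principalCongruenceLevel 2 ℚ (Ideal.span {(N : 𝓞 ℚ)}))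
          (heckeDiagAt 2 ℚ v (Rat.localUniformizer v) 2) (adelicLiftFunA N 1 f) = e • adelicLiftFunA N 1 f := by
  have h𝔫 : (Ideal.span {(N : 𝓞 ℚ)} : Ideal (𝓞 ℚ)) ≠ 0 := Rat.span_natCast_ne_zero N
  have hfixmem := adelicLiftFunA_mem_fixedPoints_principalCongruenceLevel (k := 1) f
  have hfix : ∀ u ∈ principalCongruenceLevel 2 ℚ (Ideal.span {(N : 𝓞 ℚ)}),
      rightTranslation (AdelicGroupData.gl 2 ℚ) u (adelicLiftFunA N 1 f) = adelicLiftFunA N 1 f := fun u hu =>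
    ((rightTranslation (AdelicGroupData.gl 2 ℚ)).mem_fixedPoints _ (adelicLiftFunA N 1 f)).1 hfixmem u hu
  -- the scalars of Flath's theorem, exact since `W' = ⊥`
  have hscalar : ∀ i : ℕ, ∃ c : ℂ, heckeOperator (rightTranslation (AdelicGroupData.gl 2 ℚ))
      (show Subgroup (AdelicGroupData.gl 2 ℚ).Adelic from principalCongruenceLevel 2 ℚ (Ideal.span {(N : 𝓞 ℚ)}))
      (heckeDiagAt 2 ℚ v (Rat.localUniformizer v) i) (adelicLiftFunA N 1 f) = c • adelicLiftFunA N 1 f := by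
    intro i
    obtain ⟨c, hc⟩ := π.Flath1979_heckeOperator_ofLocal_sub_smul_mem_holds v
      (glDiagonal 2 (v.adicCompletion ℚ) fun j => if (j : ℕ) < i then Rat.localUniformizer v else 1)
    have h := hc h𝔫 hv (adelicLiftFunA N 1 f) hfW hfix
    rw [← heckeDiagAt_eq_ofLocal_glDiagonal, hbot, Submodule.mem_bot, sub_eq_zero] at h
    exact ⟨c, h⟩
  obtain ⟨c₁, hc₁⟩ := hscalar 1
  obtain ⟨c₂, hc₂⟩ := hscalar 2
  -- the lift identities
  have L₁ := heckeOperator_principalCongruenceLevel_adelicLiftFunA_one (k := 1) f hv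
  have L₂ := heckeOperator_principalCongruenceLevel_adelicLiftFunA_two (k := 1) f hv
  have hs0 : ((Real.sqrt (natGenerator v) : ℝ) : ℂ) ≠ 0 := by
    exact_mod_cast (Real.sqrt_pos.2 (Nat.cast_pos.2 (prime_natGenerator v).pos)).ne'
  have hpow : ((((Real.sqrt (natGenerator v) : ℝ) : ℂ) ^ ((1 : ℤ) - 2))⁻¹) = ((Real.sqrt (natGenerator v) : ℝ) : ℂ) := by
    rw [show ((1 : ℤ) - 2) = -1 by norm_num, zpow_neg_one, inv_inv]
  rw [hpow] at L₁
  -- `φ_{T_p f} = (c₁ / √p) φ_f`, `φ_{⟨p⟩ f} = c₂ φ_f`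
  have E₁ : adelicLiftFunA N 1 (EllipticCurves.ModularForms.heckeT (Gamma1 N) 1 (natGenerator v) f) =
      ((((Real.sqrt (natGenerator v) : ℝ) : ℂ))⁻¹ * c₁) • adelicLiftFunA N 1 f := by
    rw [mul_smul, ← hc₁, L₁, inv_smul_smul₀ hs0]
  have E₂ : adelicLiftFunA N 1 (diamondOp N 1 ((natGenerator v : ℕ) : ZMod N) f) = c₂ • adelicLiftFunA N 1 f := by
    rw [← L₂, hc₂]
  refine ⟨(((Real.sqrt (natGenerator v) : ℝ) : ℂ))⁻¹ * c₁, c₂, CuspForm.eq_smul_of_adelicLiftFun_eq_smul E₁,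
    CuspForm.eq_smul_of_adelicLiftFun_eq_smul E₂, ?_, hc₂⟩
  rw [hc₁, ← mul_assoc, mul_inv_cancel₀ hs0, one_mul]

/-- **`f ∈ S₁(N, χ)` for some Dirichlet character `χ`** when `f ≠ 0` and `φ_f ∈ W`, `π = W / ⊥`:
every unit `d` mod `N` is the class of a prime `p ∤ N` (Dirichlet), `⟨d⟩ = ⟨p⟩` acts on `f` by a
scalar `c(d)` (`exists_heckeT_eq_smul_of_adelicLiftFunA_mem`), and `d ↦ c(d)` is a character since
`⟨1⟩ = 1`, `⟨d e⟩ = ⟨d⟩⟨e⟩` (`diamondOp_mul_holds`) and `f ≠ 0` (Diamond–Shurman §5.2, p. 169: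
`S_k(Γ₁(N)) = ⊕_χ S_k(N, χ)`). [cite: DiamondShurman2005, §5.2 p. 169] -/
theorem exists_mem_nebentypusSubspace_of_adelicLiftFunA_mem (hbot : π.W' = ⊥) {f : CuspForm (Gamma1 N) 1}
    (hf0 : f ≠ 0) (hfW : adelicLiftFunA N 1 f ∈ π.W) :
    ∃ χ : DirichletCharacter ℂ N, f ∈ nebentypusSubspace N 1 χ := by
  -- `⟨d⟩ f = c(d) f` for every unit `d`
  have hD : ∀ d : (ZMod N)ˣ, ∃ c : ℂ, diamondOp N 1 (d : ZMod N) f = c • f := by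
    intro d
    obtain ⟨p, -, hp, hpd⟩ := Nat.forall_exists_prime_gt_and_eq_mod (Units.isUnit d) 0
    have hpN : ¬ p ∣ N := (ZMod.isUnit_prime_iff_not_dvd hp).1 (hpd ▸ Units.isUnit d)
    set v : HeightOneSpectrum (𝓞 ℚ) := (primesEquiv (R := 𝓞 ℚ)).symm ⟨p, hp⟩ with hvdef
    have hvp : natGenerator v = p := natGenerator_primesEquiv_symm' ⟨p, hp⟩
    have hv : ¬ v.asIdeal ∣ Ideal.span {(N : 𝓞 ℚ)} := fun h => hpN (hvp ▸ (Rat.natGenerator_dvd_iff v N).2 h)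
    obtain ⟨-, e, -, he, -, -⟩ := exists_heckeT_eq_smul_of_adelicLiftFunA_mem hbot f hfW hv
    refine ⟨e, ?_⟩
    rw [← hpd, ← hvp]
    exact he
  choose c hc using hD
  have hsmul : ∀ {a b : ℂ}, a • f = b • f → a = b := fun {a b} h => smul_left_cancel_of_ne_zero hf0 h
  have hone : c 1 = 1 := hsmul (by
    rw [← hc 1, Units.val_one, ModularForms.diamondOp_one_apply, one_smul])
  have hmul : ∀ d e, c (d * e) = c d * c e := fun d e => hsmul (by
    rw [← hc (d * e), Units.val_mul, diamondOp_mul_holds N 1 d.isUnit e.isUnit, Module.End.mul_apply, hc e,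
      map_smul, hc d, smul_smul, mul_comm])
  have hne : ∀ d, c d ≠ 0 := fun d h0 => by
    have h := hmul d d⁻¹
    rw [mul_inv_cancel, hone, h0, zero_mul] at h
    exact one_ne_zero h
  let θ : (ZMod N)ˣ →* ℂˣ :=
    { toFun := fun d => Units.mk0 (c d) (hne d)
      map_one' := Units.ext hone
      map_mul' := fun d e => Units.ext (hmul d e) }
  refine ⟨MulChar.ofUnitHom θ, ?_⟩
  rw [nebentypusSubspace, Submodule.mem_iInf]
  intro d
  rw [LinearMap.mem_ker, LinearMap.sub_apply, LinearMap.smul_apply, LinearMap.id_apply, MulChar.ofUnitHom_coe, hc d,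
    sub_eq_zero]
  rfl

/-- The Satake polynomial of a pair: `(X - α)(X - β) = X² - e₁ X + e₂`. [folklore] -/
theorem satakePolynomial_eq_of_card_eq_two {α : Multiset ℂ} (hcard : Multiset.card α = 2) (h0 : α.esymm 0 = 1) :
    satakePolynomial α = X ^ 2 - C (α.esymm 1) * X + C (α.esymm 2) := by
  rw [satakePolynomial, Multiset.prod_X_sub_X_eq_sum_esymm, hcard]
  simp only [Finset.sum_range_succ, Finset.sum_range_zero, zero_add, h0, map_one, pow_zero, one_mul, mul_one,
    Nat.sub_zero, pow_one, tsub_eq_zero_of_le, le_refl]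
  norm_num
  ring

/-- **The Satake parameter of `π` at `p ∤ N` from `φ_f ∈ W`** (`π = W / ⊥`, `f ≠ 0`): if
`T_p f = a f` and `⟨p⟩ f = e f`, then `π` has at the place over `p` the Satake parameter `{α, β}`
with `(X - α)(X - β) = X² - a X + e` — the witness is the `K(N)`-spherical vector `φ_f` with
`T_{p,1} φ_f = √p a φ_f`, `T_{p,2} φ_f = e φ_f`, `T_{p,0} φ_f = φ_f`, in the normalisation
`q^{i(n-i)/2} e_i` of `HasSatakeParamAt` (Gelbart 1997, (2.5.1) and Corollary for `k = 1`:
`a_p = μ₁(p) + μ₂(p)`, `ψ(p) = μ₁(p) μ₂(p)`). [cite: Gelbart1997, Prop. 2.5 (b), (2.5.1) and Corollary] -/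
theorem hasSatakeParamAt_of_adelicLiftFunA_mem (hbot : π.W' = ⊥) {f : CuspForm (Gamma1 N) 1} (hf0 : f ≠ 0)
    (hfW : adelicLiftFunA N 1 f ∈ π.W) {v : HeightOneSpectrum (𝓞 ℚ)} (hv : ¬ v.asIdeal ∣ Ideal.span {(N : 𝓞 ℚ)})
    {a e : ℂ} (hT : EllipticCurves.ModularForms.heckeT (Gamma1 N) 1 (natGenerator v) f = a • f)
    (hD : diamondOp N 1 ((natGenerator v : ℕ) : ZMod N) f = e • f) :
    ∃ α : Multiset ℂ, π.HasSatakeParamAt v α ∧ satakePolynomial α = X ^ 2 - C a * X + C e := by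
  have h𝔫 : (Ideal.span {(N : 𝓞 ℚ)} : Ideal (𝓞 ℚ)) ≠ 0 := Rat.span_natCast_ne_zero N
  obtain ⟨a', e', hT', hD', h₁, h₂⟩ := exists_heckeT_eq_smul_of_adelicLiftFunA_mem hbot f hfW hv
  have ha : a' = a := smul_left_cancel_of_ne_zero hf0 (hT'.symm.trans hT)
  have he : e' = e := smul_left_cancel_of_ne_zero hf0 (hD'.symm.trans hD)
  subst ha he
  have hfixmem := adelicLiftFunA_mem_fixedPoints_principalCongruenceLevel (k := 1) f
  have hfix : ∀ u ∈ principalCongruenceLevel 2 ℚ (Ideal.span {(N : 𝓞 ℚ)}),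
      rightTranslation (AdelicGroupData.gl 2 ℚ) u (adelicLiftFunA N 1 f) = (adelicLiftFunA N 1 f) := fun u hu =>
    ((rightTranslation (AdelicGroupData.gl 2 ℚ)).mem_fixedPoints _ (adelicLiftFunA N 1 f)).1 hfixmem u hu
  have hφ0 : (adelicLiftFunA N 1 f) ≠ 0 := by
    intro h0
    apply hf0
    have h1 : adelicLiftFun N 1 ⇑f = (0 : ℂ) • adelicLiftFun N 1 ⇑f := by
      rw [zero_smul]; exact h0
    have := CuspForm.eq_smul_of_adelicLiftFun_eq_smul h1
    rwa [zero_smul] at this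
  -- the multiset with `e₀ = 1`, `e₁ = a'`, `e₂ = e'`
  obtain ⟨α, hcard, hα⟩ := exists_multiset_esymm_eq 2
    (fun i => if i = 0 then (1 : ℂ) else if i = 1 then a' else e') (if_pos rfl)
  have hα0 : α.esymm 0 = 1 := by rw [hα 0 (by norm_num)]; rfl
  have hα1 : α.esymm 1 = a' := by rw [hα 1 (by norm_num)]; rfl
  have hα2 : α.esymm 2 = e' := by rw [hα 2 le_rfl]; rfl
  refine ⟨α, ⟨Ideal.span {(N : 𝓞 ℚ)}, Rat.localUniformizer v, h𝔫, hv, Rat.valued_localUniformizer v, hcard, (adelicLiftFunA N 1 f), hfW,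
    ?_, hfix, fun i hi => ?_⟩, by rw [satakePolynomial_eq_of_card_eq_two hcard hα0, hα1, hα2]⟩
  · rw [hbot]
    exact fun h => hφ0 ((Submodule.mem_bot ℂ).1 h)
  · rw [hbot, Submodule.mem_bot, sub_eq_zero, GaloisRepresentations.Rat.residueCard_eq_natGenerator]
    interval_cases i
    · -- `T_{v,0} = 1`
      rw [heckeDiagAt_zero, hα0, Nat.zero_mul, pow_zero, one_mul, one_smul]
      exact heckeOperator_one_apply _ _ hfixmem
    · rw [hα1]
      simpa using h₁
    · rw [hα2]
      simpa using h₂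

/-- **The newform of the eigenform `f` computes the Satake parameters of `π` away from `N`.** Let
`π = W / ⊥` be an automorphic representation of `GL₂(𝔸_ℚ)` and `f ∈ S₁(Γ₁(N))`, `f ≠ 0`, with
`φ_f ∈ W`. Then there are `M₀ ∣ N` and a newform `g₀ ∈ S₁(Γ₁(M₀))` (`IsNewform1`) such that for
every finite place `v` of `ℚ` over a prime `p ∤ N`, `π` has a Satake parameter `α` at `v` with
`∏_{a ∈ α} (X - a) = X² - a_p(g₀) X + ε_{g₀}(p)`, the Hecke polynomial of `g₀` at `p` (weight one).
Assembly: `f ∈ S₁(N, χ)` is an eigenform away from `N`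
(`exists_heckeT_eq_smul_of_adelicLiftFunA_mem`, `exists_mem_nebentypusSubspace_of_adelicLiftFunA_mem`),
its eigenvalue packet is that of a newform `g₀` of level `M₀ ∣ N` (Atkin–Lehner–Li,
`exists_isNewform1_of_eigenpacket`), and the packet gives the Satake parameters
(`hasSatakeParamAt_of_adelicLiftFunA_mem`). Gelbart 1997, Prop. 2.5 and Corollary (`k = 1`:
"`a_p = μ₁(p) + μ₂(p)` for all `p ∤ N`"), for the primes not dividing the auxiliary level `N`.
[cite: Gelbart1997, Prop. 2.5 and Corollary] [cite: DiamondShurman2005, Thm. 5.8.2–5.8.3] -/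
theorem exists_isNewform1_satake_of_adelicLiftFunA_mem (hbot : π.W' = ⊥) {f : CuspForm (Gamma1 N) 1}
    (hf0 : f ≠ 0) (hfW : adelicLiftFunA N 1 f ∈ π.W) :
    ∃ (M₀ : ℕ) (_ : NeZero M₀) (_ : M₀ ∣ N) (g₀ : CuspForm (Gamma1 M₀) 1), IsNewform1 g₀ ∧
      ∀ v : HeightOneSpectrum (𝓞 ℚ), ¬ ((primesEquiv v : Nat.Primes) : ℕ) ∣ N →
        ∃ α : Multiset ℂ, π.HasSatakeParamAt v α ∧
          satakePolynomial α =
            (EllipticCurves.ModularForms.heckePolynomial g₀ (primesEquiv v : Nat.Primes)).map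
              (algebraMap (coeffCharField g₀) ℂ) := by
  classical
  obtain ⟨χ, hfχ⟩ := exists_mem_nebentypusSubspace_of_adelicLiftFunA_mem hbot hf0 hfW
  -- the eigenvalues `a p` of `T_p`, `p ∤ N`
  have hTv : ∀ v : HeightOneSpectrum (𝓞 ℚ), ¬ v.asIdeal ∣ Ideal.span {(N : 𝓞 ℚ)} →
      ∃ a : ℂ, EllipticCurves.ModularForms.heckeT (Gamma1 N) 1 (natGenerator v) f = a • f := fun v hv => by
    obtain ⟨a, -, ha, -⟩ := exists_heckeT_eq_smul_of_adelicLiftFunA_mem hbot f hfW hv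
    exact ⟨a, ha⟩
  -- `p ↦` the place over `p`, and `natGenerator`/`primesEquiv` bookkeeping
  have hvN : ∀ v : HeightOneSpectrum (𝓞 ℚ), ¬ natGenerator v ∣ N → ¬ v.asIdeal ∣ Ideal.span {(N : 𝓞 ℚ)} :=
    fun v h hv => h ((Rat.natGenerator_dvd_iff v N).2 hv)
  -- prime-indexed eigenvalues `T_p f = a_p f`, `p ∤ N`
  have hTp : ∀ (p : ℕ) (hp : p.Prime), ¬ p ∣ N →
      ∃ a : ℂ, (haveI : NeZero p := ⟨hp.ne_zero⟩; EllipticCurves.ModularForms.heckeT (Gamma1 N) 1 p f) = a • f := by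
    intro p hp hpN
    set v : HeightOneSpectrum (𝓞 ℚ) := (primesEquiv (R := 𝓞 ℚ)).symm ⟨p, hp⟩ with hvdef
    have hvp : natGenerator v = p := natGenerator_primesEquiv_symm' ⟨p, hp⟩
    obtain ⟨a, ha⟩ := hTv v (hvN v (by rw [hvp]; exact hpN))
    refine ⟨a, ?_⟩
    have gen : ∀ (q : ℕ) (hq : NeZero q), q = p →
        (haveI := hq; EllipticCurves.ModularForms.heckeT (Gamma1 N) 1 q f) = a • f →
          (haveI : NeZero p := ⟨hp.ne_zero⟩; EllipticCurves.ModularForms.heckeT (Gamma1 N) 1 p f) = a • f := by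
      rintro q hq rfl h; exact h
    exact gen (natGenerator v) inferInstance hvp ha
  let a : ℕ → ℂ := fun p => if h : p.Prime ∧ ¬ p ∣ N then Classical.choose (hTp p h.1 h.2) else 0
  have hT : ∀ (p : ℕ) (hp : p.Prime), ¬ p ∣ N →
      (haveI : NeZero p := ⟨hp.ne_zero⟩; EllipticCurves.ModularForms.heckeT (Gamma1 N) 1 p f) = a p • f := by
    intro p hp hpN
    have hdef : a p = Classical.choose (hTp p hp hpN) := dif_pos ⟨hp, hpN⟩
    rw [hdef]
    exact Classical.choose_spec (hTp p hp hpN)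
  obtain ⟨M₀, hM₀0, hM₀, g₀, hg₀, hcoeff, hχ⟩ := exists_isNewform1_of_eigenpacket hf0 hfχ hT
  refine ⟨M₀, hM₀0, hM₀, g₀, hg₀, fun v hvN' => ?_⟩
  have hvN'' : ¬ natGenerator v ∣ N := hvN'
  have hv := hvN v hvN''
  -- the diamond eigenvalue is `χ(p)`
  obtain ⟨u, hu⟩ := ZMod.isUnit_prime_of_not_dvd (prime_natGenerator v) hvN''
  have hD : diamondOp N 1 ((natGenerator v : ℕ) : ZMod N) f = χ ((natGenerator v : ℕ) : ZMod N) • f := by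
    rw [← hu]
    exact (mem_nebentypusSubspace_iff_diamondOp.mp hfχ) u
  obtain ⟨α, hsat, hpoly⟩ := hasSatakeParamAt_of_adelicLiftFunA_mem hbot hf0 hfW hv
    (hT _ (prime_natGenerator v) hvN'') hD
  refine ⟨α, hsat, ?_⟩
  rw [hpoly, map_heckePolynomial]
  have hp : ((primesEquiv (R := 𝓞 ℚ) v : Nat.Primes) : ℕ) = natGenerator v := rfl
  have hc' := hcoeff _ (prime_natGenerator v) hvN''
  simp only [cuspCoeff] at hc'
  rw [hp, sub_self, zpow_zero, mul_one, hc', ← hχ, ← hu, DirichletCharacter.changeLevel_eq_cast_of_dvd _ hM₀ u, hu,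
    ZMod.cast_natCast hM₀]

end AutomorphicRepData

end Literature.NumberTheory.Automorphic

end
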